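import Literature.NumberTheory.LFunctions.Zhang2022.Section8RangeEngine
import Literature.NumberTheory.LFunctions.Zhang2022.Section9FrontEndExact
import HarnessLib

/-!
# Zhang (2022) §9 p. 51: the partial summation half (PS9) of `Z22:§9.u004`, via d29's range-sum engine

Y. Zhang, *Discrete mean estimates and the Landau–Siegel zero*, arXiv:2211.02515v1 (2022)
[Zhang2022LandauSiegel] — **an unrefereed manuscript under adjudication; nothing here asserts anything about
its Theorems 1–2 or about Landau–Siegel zeros.** Campaign cell `siegel-zhang` (D-0069), discharge seat d17,
cone leaf C23 (`Skeleton.Ded97`), node `Z22:§9.u004` ("in a way similar to the proof of (8.12)").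
`Section9FrontEndExact.step9u004r_of_parts` reduced `Step9u004r` to two analytic sub-claims (G9) (gathering)
and (PS9) (partial summation). This file PROVES (PS9) — the §9 twin of `Z22:(8.11)`/`Ded811`:

`L′(1,χ)²[Σ_{n<P₃}|χ(n)|λ₀ⱼ(n)/φ(n)·Φ(n) + Σ_{P₃≤n<P₂}|χ(n)|λ₀ⱼ(n)/φ(n)·Ψ(n)]
   = 𝔞(∫₁^{P₃}Φ(x)dx/x + |ι₄|²(log P₂)⁻²∫_{P₃}^{P₂}𝔣_{j7}𝔤_{j7}(P₂/x)dx/x) + o(α)`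

with `Φ(x) = (ῑ₃𝔣_{j6}(P₃/x)/log P₃ + ῑ₄𝔣_{j7}(P₂/x)/log P₂)(ι₃𝔤_{j6}(P₃/x)/log P₃ + ι₄𝔤_{j7}(P₂/x)/log P₂)`,
`Ψ(x) = ῑ₄ι₄𝔣_{j7}𝔤_{j7}(P₂/x)/(log P₂)²` — three applications of d29's scale-generic engine
`Section8RangeEngine.weighted_sum_integral_eval` (profiles `Φ` on `[1,P₃]`, `Ψ` on `[1,P₂]` and `[1,P₃]`),
with the profile bounds `Section8AbelProfiles.frakfW_div_bounds / frakgW_div_bounds / mul_bounds` (d29)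
at the scales `Q = P₃, P₂` (`‖Φ‖, ‖Ψ‖ ≪ 𝓛⁻¹⁸`, `‖Φ′‖, ‖Ψ′‖ ≪ α𝓛⁻¹⁸/t`); total error `O(𝓛⁻¹²) = o(α)`.
Corollary `step9u004r_of_gathering9`: `Step9u004r` now follows from (G9) ALONE.

Theorem-only; 0 definitions, 0 new facts.

## References

* Y. Zhang, arXiv:2211.02515v1 (2022), §9 p. 51, tex L2613–L2618; §8 (8.11) p. 48, tex L2452–L2469.
  [cite: Zhang2022LandauSiegel, §9 p.51]
-/

noncomputable section

open Complex Real ComplexConjugate Set MeasureTheory Finset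

namespace Literature.NumberTheory.LFunctions.Zhang2022.Section9PartialSummation

open Skeleton Section8AbelProfiles Section8RangeEngine

/-! ### Parameters -/

/-- `3 ≤ 𝓛` once `D ≥ 21`. [cite: Zhang2022LandauSiegel, §2 (2.1)] -/
private theorem four_le_ell {D : ℕ} (hD : ⌈Real.exp 4⌉₊ ≤ D) : 4 ≤ ell D := by
  have hexp : Real.exp 4 ≤ D := le_trans (Nat.le_ceil _) (by exact_mod_cast hD)
  rw [ell]
  exact (Real.le_log_iff_exp_le (lt_of_lt_of_le (Real.exp_pos _) hexp)).mpr hexp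

/-- `c ≤ 𝓛` once `D ≥ ⌈e^c⌉`. [cite: Zhang2022LandauSiegel, §2 (2.1)] -/
private theorem le_ell_of_le' {c : ℝ} {D : ℕ} (hD : ⌈Real.exp c⌉₊ ≤ D) : c ≤ ell D := by
  have hexp : Real.exp c ≤ D := le_trans (Nat.le_ceil _) (by exact_mod_cast hD)
  rw [ell]
  exact (Real.le_log_iff_exp_le (lt_of_lt_of_le (Real.exp_pos _) hexp)).mpr hexp

/-- `‖ι₃‖ + ‖ι₄‖ ≤ 3.53` ((2.26): `ι₃ = −1.00635 − 0.22789i`, `ι₄ = −0.68738 + 1.60688i`; `‖z‖ ≤ |Re z| + |Im z|`).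
[cite: Zhang2022LandauSiegel, §2 (2.26)] -/
private theorem norm_iota34_le : ‖iota3‖ + ‖iota4‖ ≤ 3.53 := by
  have h3 := Complex.norm_le_abs_re_add_abs_im iota3
  have h4 := Complex.norm_le_abs_re_add_abs_im iota4
  have r3 : iota3.re = -1.00635 := by simp [iota3]
  have i3 : iota3.im = -0.22789 := by simp [iota3]
  have r4 : iota4.re = -0.68738 := by simp [iota4]
  have i4 : iota4.im = 1.60688 := by simp [iota4]
  rw [r3, i3] at h3; rw [r4, i4] at h4
  norm_num at h3 h4
  linarith

/-- The scale facts for `𝓛 ≥ 4`: `log P₃ = 0.498𝓛⁹`, `0.498𝓛⁹ ≤ log P₂ ≤ 0.5𝓛⁹`, `2 ≤ P₃ ≤ P₂ ≤ P`.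
[cite: Zhang2022LandauSiegel, §2 (2.6), (2.21)] -/
private theorem scale_facts {D : ℕ} (hℓ : 4 ≤ ell D) :
    Real.log (Skeleton.P3 D) = 0.498 * ell D ^ 9 ∧
      0.498 * ell D ^ 9 ≤ Real.log (Skeleton.P2 D) ∧ Real.log (Skeleton.P2 D) ≤ 0.5 * ell D ^ 9 ∧
      2 ≤ Skeleton.P3 D ∧ Skeleton.P3 D ≤ Skeleton.P2 D ∧ Skeleton.P2 D ≤ bigP D := by
  have h1 : 1 ≤ ell D := by linarith
  have hP : 0 < bigP D := Real.exp_pos _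
  have hT : 0 < bigT D := Real.exp_pos _
  have hP3pos : 0 < Skeleton.P3 D := Real.rpow_pos_of_pos hP _
  have hP2pos : 0 < Skeleton.P2 D := div_pos (Real.rpow_pos_of_pos hP _) (pow_pos hT _)
  have e3 : Real.log (Skeleton.P3 D) = 0.498 * ell D ^ 9 := by
    rw [Skeleton.P3, Real.log_rpow hP, log_bigP]
  have e2 : Real.log (Skeleton.P2 D) = 0.5 * ell D ^ 9 - 10 * ell D ^ (1.1 : ℝ) := by
    rw [Skeleton.P2, Real.log_div (Real.rpow_pos_of_pos hP _).ne' (pow_pos hT _).ne',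
      Real.log_rpow hP, log_bigP, Real.log_pow, bigT, Real.log_exp]
    push_cast; ring
  have hr0 : 0 ≤ ell D ^ (1.1 : ℝ) := Real.rpow_nonneg (by linarith) _
  have hr2 : ell D ^ (1.1 : ℝ) ≤ ell D ^ 2 := by
    have := Real.rpow_le_rpow_of_exponent_le h1 (by norm_num : (1.1 : ℝ) ≤ 2)
    rwa [Real.rpow_two] at this
  have h7 : (4:ℝ) ^ 7 ≤ ell D ^ 7 := pow_le_pow_left₀ (by norm_num) hℓ 7
  have h9 : (4:ℝ) ^ 9 ≤ ell D ^ 9 := pow_le_pow_left₀ (by norm_num) hℓ 9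
  have h10 : 10 * ell D ^ 2 ≤ 0.002 * ell D ^ 9 := by
    rw [show ell D ^ 9 = ell D ^ 2 * ell D ^ 7 by ring]
    nlinarith [pow_nonneg (by linarith : (0:ℝ) ≤ ell D) 2]
  have hlo : 0.498 * ell D ^ 9 ≤ Real.log (Skeleton.P2 D) := by rw [e2]; linarith
  have hhi : Real.log (Skeleton.P2 D) ≤ 0.5 * ell D ^ 9 := by rw [e2]; linarith
  refine ⟨e3, hlo, hhi, ?_, ?_, ?_⟩
  · -- `2 ≤ P₃`: `log 2 ≤ 1 ≤ 0.498𝓛⁹`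
    have h2 : Real.log 2 ≤ Real.log (Skeleton.P3 D) := by
      rw [e3]; have := Real.log_two_lt_d9; nlinarith
    exact (Real.log_le_log_iff (by norm_num) hP3pos).mp h2
  · exact (Real.log_le_log_iff hP3pos hP2pos).mp (by rw [e3]; exact hlo)
  · rw [← Real.log_le_log_iff hP2pos hP, log_bigP]
    nlinarith

/-- `κ₉ = ‖ι₃‖/log P₃ + ‖ι₄‖/log P₂ ≤ 10𝓛⁻⁹` for `𝓛 ≥ 4`. [cite: Zhang2022LandauSiegel, §2 (2.21), (2.26)] -/
private theorem kappa9_le {ℓ L3 L2 : ℝ} (hℓ : 4 ≤ ℓ) (hL3 : L3 = 0.498 * ℓ ^ 9) (hL2 : 0.498 * ℓ ^ 9 ≤ L2) :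
    ‖iota3‖ / L3 + ‖iota4‖ / L2 ≤ 10 / ℓ ^ 9 := by
  have h9 : 0 < ℓ ^ 9 := by positivity
  have hL3pos : 0 < L3 := by rw [hL3]; positivity
  have hL2pos : 0 < L2 := lt_of_lt_of_le (by positivity) hL2
  have hι := norm_iota34_le
  have h3 : ‖iota3‖ / L3 ≤ ‖iota3‖ / (0.498 * ℓ ^ 9) := by rw [hL3]
  have h4 : ‖iota4‖ / L2 ≤ ‖iota4‖ / (0.498 * ℓ ^ 9) :=
    div_le_div_of_nonneg_left (norm_nonneg _) (by positivity) hL2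
  have h5 : ‖iota3‖ / (0.498 * ℓ ^ 9) + ‖iota4‖ / (0.498 * ℓ ^ 9) ≤ 10 / ℓ ^ 9 := by
    rw [← add_div, div_le_div_iff₀ (by positivity) h9]
    nlinarith [norm_nonneg iota3, norm_nonneg iota4]
  linarith

/-- `α log(P₂ + 1) ≤ 4` (`α = π/𝓛⁹`, `log P₂ ≤ 0.5𝓛⁹`, `𝓛 ≥ 4`). [cite: Zhang2022LandauSiegel, §2 (2.10), (2.21)] -/
private theorem alpha_log_succ_P2_le {ℓ P2 : ℝ} (hℓ : 4 ≤ ℓ) (hP2 : 1 ≤ P2)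
    (hlog : Real.log P2 ≤ 0.5 * ℓ ^ 9) : π / ℓ ^ 9 * Real.log (P2 + 1) ≤ 4 := by
  have h9 : 0 < ℓ ^ 9 := by positivity
  have h9' : (4 : ℝ) ^ 9 ≤ ℓ ^ 9 := pow_le_pow_left₀ (by norm_num) hℓ 9
  have hP0 : 0 < P2 := by linarith
  have hlog2 : Real.log (P2 + 1) ≤ 1 + 0.5 * ℓ ^ 9 := by
    have h1 : P2 + 1 ≤ 2 * P2 := by linarith
    have h2 : Real.log (P2 + 1) ≤ Real.log (2 * P2) := Real.log_le_log (by linarith) h1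
    rw [Real.log_mul (by norm_num) hP0.ne'] at h2
    have h3 : Real.log 2 ≤ 1 := by have := Real.log_two_lt_d9; linarith
    linarith
  have hπ4 : π ≤ 4 := by have := Real.pi_lt_d2; linarith
  rw [div_mul_eq_mul_div, div_le_iff₀ h9]
  have hlog0 : 0 ≤ Real.log (P2 + 1) := Real.log_nonneg (by linarith)
  calc π * Real.log (P2 + 1) ≤ 4 * (1 + 0.5 * ℓ ^ 9) := by nlinarith [Real.pi_pos]
    _ ≤ 4 * ℓ ^ 9 := by nlinarith

/-- The engine error for a product profile with bounds `29κ·146κ`, `(94ακ·146κ + 29κ·449ακ)/t`: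
`C𝓛⁶(M + M′𝓛⁹) ≤ |C|(423400 + 2674500π)𝓛⁻¹²` for `κ ≤ 10𝓛⁻⁹`, `α = π𝓛⁻⁹` (d29's `errF_le`, private copy).
[cite: Zhang2022LandauSiegel, §8 (8.11) p.48] -/
private theorem errF_le {ℓ κ C : ℝ} (hℓ : 3 ≤ ℓ) (hκ0 : 0 ≤ κ) (hκ : κ ≤ 10 / ℓ ^ 9) :
    C * ℓ ^ 6 * (29 * κ * (146 * κ) +
        (94 * (π / ℓ ^ 9) * κ * (146 * κ) + 29 * κ * (449 * (π / ℓ ^ 9) * κ)) * ℓ ^ 9) ≤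
      |C| * (423400 + 2674500 * π) / ℓ ^ 12 := by
  have hℓ0 : 0 < ℓ := by linarith
  have h9 : 0 < ℓ ^ 9 := by positivity
  have hκ2 : κ ^ 2 ≤ 100 / ℓ ^ 18 := by
    calc κ ^ 2 ≤ (10 / ℓ ^ 9) ^ 2 := pow_le_pow_left₀ hκ0 hκ 2
      _ = 100 / ℓ ^ 18 := by rw [div_pow]; ring
  have e : C * ℓ ^ 6 * (29 * κ * (146 * κ) +
        (94 * (π / ℓ ^ 9) * κ * (146 * κ) + 29 * κ * (449 * (π / ℓ ^ 9) * κ)) * ℓ ^ 9) =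
      C * ((4234 + 26745 * π) * (ℓ ^ 6 * κ ^ 2)) := by
    field_simp
    ring
  rw [e]
  have hx0 : 0 ≤ (4234 + 26745 * π) * (ℓ ^ 6 * κ ^ 2) := by positivity
  have hx : (4234 + 26745 * π) * (ℓ ^ 6 * κ ^ 2) ≤ (423400 + 2674500 * π) / ℓ ^ 12 := by
    have h1 : ℓ ^ 6 * κ ^ 2 ≤ ℓ ^ 6 * (100 / ℓ ^ 18) := mul_le_mul_of_nonneg_left hκ2 (by positivity)
    have h2 : ℓ ^ 6 * (100 / ℓ ^ 18) = 100 / ℓ ^ 12 := by field_simp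
    calc (4234 + 26745 * π) * (ℓ ^ 6 * κ ^ 2) ≤ (4234 + 26745 * π) * (100 / ℓ ^ 12) := by
          rw [← h2]; exact mul_le_mul_of_nonneg_left h1 (by positivity)
      _ = (423400 + 2674500 * π) / ℓ ^ 12 := by ring
  calc C * ((4234 + 26745 * π) * (ℓ ^ 6 * κ ^ 2)) ≤ |C| * ((4234 + 26745 * π) * (ℓ ^ 6 * κ ^ 2)) :=
        mul_le_mul_of_nonneg_right (le_abs_self C) hx0
    _ ≤ |C| * ((423400 + 2674500 * π) / ℓ ^ 12) := mul_le_mul_of_nonneg_left hx (abs_nonneg C)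
    _ = |C| * (423400 + 2674500 * π) / ℓ ^ 12 := by ring

/-- `|C|·Q·𝓛⁻¹² ≤ (ε/2)α` once `𝓛 ≥ 2|C|Q/(επ)` (`α = π𝓛⁻⁹`, `𝓛 ≥ 3`; d29's `total_err_le`, private copy).
[cite: Zhang2022LandauSiegel, §8 (8.11) p.48] -/
private theorem total_err_le {ℓ C Q ε : ℝ} (hℓ : 3 ≤ ℓ) (hε : 0 < ε) (_hQ : 0 ≤ Q)
    (hCQ : 2 * |C| * Q / (ε * π) ≤ ℓ) : |C| * Q / ℓ ^ 12 ≤ ε / 2 * (π / ℓ ^ 9) := by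
  have hℓ0 : 0 < ℓ := by linarith
  have hℓ1 : 1 ≤ ℓ := by linarith
  have h3 : ℓ ≤ ℓ ^ 3 := le_self_pow₀ hℓ1 (by norm_num)
  have hCQ' : 2 * |C| * Q ≤ ε * π * ℓ ^ 3 := by
    have := (div_le_iff₀ (by positivity)).mp hCQ
    nlinarith [this, h3, mul_pos hε Real.pi_pos]
  rw [div_le_iff₀ (by positivity)]
  have e : ε / 2 * (π / ℓ ^ 9) * ℓ ^ 12 = ε * π * ℓ ^ 3 / 2 := by field_simp
  rw [e]
  linarith

/-! ### The §9 profile factors on `[1, T]` -/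

section Profiles

variable (c' : ℝ) {D : ℕ}

/-- A linear combination `u·𝔣_{j6}(Q₃/t)/L₃ + v·𝔣_{j7}(Q₂/t)/L₂` on `[1,T]`: differentiable, bounded by
`29(‖u‖/L₃ + ‖v‖/L₂)`, derivative `≤ 94α(‖u‖/L₃ + ‖v‖/L₂)/t` (from `frakfW_div_bounds`).
[cite: Zhang2022LandauSiegel, §9 p.51; §8 Lemma 8.2] -/
theorem mFac9_bounds (j : ℕ) (u v : ℂ) {Q3 Q2 L3 L2 T t : ℝ} (hα : 0 < alpha D) (hℓ : 0 ≤ ell D)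
    (hc : 5 * |c'| * alpha D * ell D ≤ 1) (hQ3 : 1 ≤ Q3) (hQ2 : 1 ≤ Q2) (hQ3T : Q3 ≤ T) (hQ2T : Q2 ≤ T)
    (ht1 : 1 ≤ t) (htT : t ≤ T) (hT : alpha D * Real.log T ≤ 4) (hL3 : 0 < L3) (hL2 : 0 < L2) :
    DifferentiableAt ℝ (fun w : ℝ => u * frakfW c' D j 6 (Q3 / w) / (L3 : ℂ) +
        v * frakfW c' D j 7 (Q2 / w) / (L2 : ℂ)) t ∧
      ‖u * frakfW c' D j 6 (Q3 / t) / (L3 : ℂ) + v * frakfW c' D j 7 (Q2 / t) / (L2 : ℂ)‖ ≤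
        29 * (‖u‖ / L3 + ‖v‖ / L2) ∧
      ‖deriv (fun w : ℝ => u * frakfW c' D j 6 (Q3 / w) / (L3 : ℂ) +
          v * frakfW c' D j 7 (Q2 / w) / (L2 : ℂ)) t‖ ≤ 94 * alpha D * (‖u‖ / L3 + ‖v‖ / L2) / t := by
  have ht : 0 < t := by linarith
  obtain ⟨d6, n6, n6'⟩ := frakfW_div_bounds c' j 6 hα hℓ hc hQ3 hQ3T ht1 htT hT
  obtain ⟨d7, n7, n7'⟩ := frakfW_div_bounds c' j 7 hα hℓ hc hQ2 hQ2T ht1 htT hT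
  have hL3C : ‖(L3 : ℂ)‖ = L3 := Complex.norm_of_nonneg hL3.le
  have hL2C : ‖(L2 : ℂ)‖ = L2 := Complex.norm_of_nonneg hL2.le
  have hd : HasDerivAt (fun w : ℝ => u * frakfW c' D j 6 (Q3 / w) / (L3 : ℂ) +
        v * frakfW c' D j 7 (Q2 / w) / (L2 : ℂ))
      (u * deriv (fun w : ℝ => frakfW c' D j 6 (Q3 / w)) t / (L3 : ℂ) +
        v * deriv (fun w : ℝ => frakfW c' D j 7 (Q2 / w)) t / (L2 : ℂ)) t :=
    ((d6.hasDerivAt.const_mul u).div_const _).add ((d7.hasDerivAt.const_mul v).div_const _)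
  refine ⟨hd.differentiableAt, ?_, ?_⟩
  · calc ‖u * frakfW c' D j 6 (Q3 / t) / (L3 : ℂ) + v * frakfW c' D j 7 (Q2 / t) / (L2 : ℂ)‖
        ≤ ‖u * frakfW c' D j 6 (Q3 / t) / (L3 : ℂ)‖ + ‖v * frakfW c' D j 7 (Q2 / t) / (L2 : ℂ)‖ :=
          norm_add_le _ _
      _ = ‖u‖ * ‖frakfW c' D j 6 (Q3 / t)‖ / L3 + ‖v‖ * ‖frakfW c' D j 7 (Q2 / t)‖ / L2 := by
          rw [norm_div, norm_div, norm_mul, norm_mul, hL3C, hL2C]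
      _ ≤ ‖u‖ * 29 / L3 + ‖v‖ * 29 / L2 := by gcongr
      _ = 29 * (‖u‖ / L3 + ‖v‖ / L2) := by ring
  · rw [hd.deriv]
    calc ‖u * deriv (fun w : ℝ => frakfW c' D j 6 (Q3 / w)) t / (L3 : ℂ) +
          v * deriv (fun w : ℝ => frakfW c' D j 7 (Q2 / w)) t / (L2 : ℂ)‖
        ≤ ‖u * deriv (fun w : ℝ => frakfW c' D j 6 (Q3 / w)) t / (L3 : ℂ)‖ +
          ‖v * deriv (fun w : ℝ => frakfW c' D j 7 (Q2 / w)) t / (L2 : ℂ)‖ := norm_add_le _ _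
      _ = ‖u‖ * ‖deriv (fun w : ℝ => frakfW c' D j 6 (Q3 / w)) t‖ / L3 +
          ‖v‖ * ‖deriv (fun w : ℝ => frakfW c' D j 7 (Q2 / w)) t‖ / L2 := by
          rw [norm_div, norm_div, norm_mul, norm_mul, hL3C, hL2C]
      _ ≤ ‖u‖ * (94 * alpha D / t) / L3 + ‖v‖ * (94 * alpha D / t) / L2 := by gcongr
      _ = 94 * alpha D * (‖u‖ / L3 + ‖v‖ / L2) / t := by ring

/-- The same for `u·𝔤_{j6}(Q₃/t)/L₃ + v·𝔤_{j7}(Q₂/t)/L₂`: bounds `146(…)`, `449α(…)/t`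
(from `frakgW_div_bounds`). [cite: Zhang2022LandauSiegel, §9 p.51; §8 Lemma 8.4] -/
theorem nFac9_bounds (j : ℕ) (u v : ℂ) {Q3 Q2 L3 L2 T t : ℝ} (hα : 0 < alpha D) (hℓ : 0 ≤ ell D)
    (hc : 5 * |c'| * alpha D * ell D ≤ 1) (hQ3 : 1 ≤ Q3) (hQ2 : 1 ≤ Q2) (hQ3T : Q3 ≤ T) (hQ2T : Q2 ≤ T)
    (ht1 : 1 ≤ t) (htT : t ≤ T) (hT : alpha D * Real.log T ≤ 4) (hL3 : 0 < L3) (hL2 : 0 < L2) :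
    DifferentiableAt ℝ (fun w : ℝ => u * frakgW c' D j 6 (Q3 / w) / (L3 : ℂ) +
        v * frakgW c' D j 7 (Q2 / w) / (L2 : ℂ)) t ∧
      ‖u * frakgW c' D j 6 (Q3 / t) / (L3 : ℂ) + v * frakgW c' D j 7 (Q2 / t) / (L2 : ℂ)‖ ≤
        146 * (‖u‖ / L3 + ‖v‖ / L2) ∧
      ‖deriv (fun w : ℝ => u * frakgW c' D j 6 (Q3 / w) / (L3 : ℂ) +
          v * frakgW c' D j 7 (Q2 / w) / (L2 : ℂ)) t‖ ≤ 449 * alpha D * (‖u‖ / L3 + ‖v‖ / L2) / t := by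
  have ht : 0 < t := by linarith
  obtain ⟨d6, n6, n6'⟩ := frakgW_div_bounds c' j 6 hα hℓ hc hQ3 hQ3T ht1 htT hT
  obtain ⟨d7, n7, n7'⟩ := frakgW_div_bounds c' j 7 hα hℓ hc hQ2 hQ2T ht1 htT hT
  have hL3C : ‖(L3 : ℂ)‖ = L3 := Complex.norm_of_nonneg hL3.le
  have hL2C : ‖(L2 : ℂ)‖ = L2 := Complex.norm_of_nonneg hL2.le
  have hd : HasDerivAt (fun w : ℝ => u * frakgW c' D j 6 (Q3 / w) / (L3 : ℂ) +
        v * frakgW c' D j 7 (Q2 / w) / (L2 : ℂ))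
      (u * deriv (fun w : ℝ => frakgW c' D j 6 (Q3 / w)) t / (L3 : ℂ) +
        v * deriv (fun w : ℝ => frakgW c' D j 7 (Q2 / w)) t / (L2 : ℂ)) t :=
    ((d6.hasDerivAt.const_mul u).div_const _).add ((d7.hasDerivAt.const_mul v).div_const _)
  refine ⟨hd.differentiableAt, ?_, ?_⟩
  · calc ‖u * frakgW c' D j 6 (Q3 / t) / (L3 : ℂ) + v * frakgW c' D j 7 (Q2 / t) / (L2 : ℂ)‖
        ≤ ‖u * frakgW c' D j 6 (Q3 / t) / (L3 : ℂ)‖ + ‖v * frakgW c' D j 7 (Q2 / t) / (L2 : ℂ)‖ :=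
          norm_add_le _ _
      _ = ‖u‖ * ‖frakgW c' D j 6 (Q3 / t)‖ / L3 + ‖v‖ * ‖frakgW c' D j 7 (Q2 / t)‖ / L2 := by
          rw [norm_div, norm_div, norm_mul, norm_mul, hL3C, hL2C]
      _ ≤ ‖u‖ * 146 / L3 + ‖v‖ * 146 / L2 := by gcongr
      _ = 146 * (‖u‖ / L3 + ‖v‖ / L2) := by ring
  · rw [hd.deriv]
    calc ‖u * deriv (fun w : ℝ => frakgW c' D j 6 (Q3 / w)) t / (L3 : ℂ) +
          v * deriv (fun w : ℝ => frakgW c' D j 7 (Q2 / w)) t / (L2 : ℂ)‖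
        ≤ ‖u * deriv (fun w : ℝ => frakgW c' D j 6 (Q3 / w)) t / (L3 : ℂ)‖ +
          ‖v * deriv (fun w : ℝ => frakgW c' D j 7 (Q2 / w)) t / (L2 : ℂ)‖ := norm_add_le _ _
      _ = ‖u‖ * ‖deriv (fun w : ℝ => frakgW c' D j 6 (Q3 / w)) t‖ / L3 +
          ‖v‖ * ‖deriv (fun w : ℝ => frakgW c' D j 7 (Q2 / w)) t‖ / L2 := by
          rw [norm_div, norm_div, norm_mul, norm_mul, hL3C, hL2C]
      _ ≤ ‖u‖ * (449 * alpha D / t) / L3 + ‖v‖ * (449 * alpha D / t) / L2 := by gcongr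
      _ = 449 * alpha D * (‖u‖ / L3 + ‖v‖ / L2) / t := by ring

end Profiles

/-! ### Single-term profile bounds (for the `Ψ` term) -/

section Single

variable (c' : ℝ) {D : ℕ}

/-- `w ↦ v·𝔣_{j7}(Q/t)/L` on `[1,T]`: differentiable, `≤ 29‖v‖/L`, derivative `≤ 94α(‖v‖/L)/t`.
[cite: Zhang2022LandauSiegel, §9 p.51; §8 Lemma 8.2] -/
theorem sFacF_bounds (j : ℕ) (v : ℂ) {Q L T t : ℝ} (hα : 0 < alpha D) (hℓ : 0 ≤ ell D)
    (hc : 5 * |c'| * alpha D * ell D ≤ 1) (hQ : 1 ≤ Q) (hQT : Q ≤ T) (ht1 : 1 ≤ t) (htT : t ≤ T)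
    (hT : alpha D * Real.log T ≤ 4) (hL : 0 < L) :
    DifferentiableAt ℝ (fun w : ℝ => v * frakfW c' D j 7 (Q / w) / (L : ℂ)) t ∧
      ‖v * frakfW c' D j 7 (Q / t) / (L : ℂ)‖ ≤ 29 * (‖v‖ / L) ∧
      ‖deriv (fun w : ℝ => v * frakfW c' D j 7 (Q / w) / (L : ℂ)) t‖ ≤ 94 * alpha D * (‖v‖ / L) / t := by
  obtain ⟨d7, n7, n7'⟩ := frakfW_div_bounds c' j 7 hα hℓ hc hQ hQT ht1 htT hT
  have hLC : ‖(L : ℂ)‖ = L := Complex.norm_of_nonneg hL.le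
  have hd : HasDerivAt (fun w : ℝ => v * frakfW c' D j 7 (Q / w) / (L : ℂ))
      (v * deriv (fun w : ℝ => frakfW c' D j 7 (Q / w)) t / (L : ℂ)) t :=
    (d7.hasDerivAt.const_mul v).div_const _
  refine ⟨hd.differentiableAt, ?_, ?_⟩
  · rw [norm_div, norm_mul, hLC]
    calc ‖v‖ * ‖frakfW c' D j 7 (Q / t)‖ / L ≤ ‖v‖ * 29 / L := by gcongr
      _ = 29 * (‖v‖ / L) := by ring
  · rw [hd.deriv, norm_div, norm_mul, hLC]
    calc ‖v‖ * ‖deriv (fun w : ℝ => frakfW c' D j 7 (Q / w)) t‖ / L ≤ ‖v‖ * (94 * alpha D / t) / L := by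
          gcongr
      _ = 94 * alpha D * (‖v‖ / L) / t := by ring

/-- `w ↦ v·𝔤_{j7}(Q/t)/L` on `[1,T]`: differentiable, `≤ 146‖v‖/L`, derivative `≤ 449α(‖v‖/L)/t`.
[cite: Zhang2022LandauSiegel, §9 p.51; §8 Lemma 8.4] -/
theorem sFacG_bounds (j : ℕ) (v : ℂ) {Q L T t : ℝ} (hα : 0 < alpha D) (hℓ : 0 ≤ ell D)
    (hc : 5 * |c'| * alpha D * ell D ≤ 1) (hQ : 1 ≤ Q) (hQT : Q ≤ T) (ht1 : 1 ≤ t) (htT : t ≤ T)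
    (hT : alpha D * Real.log T ≤ 4) (hL : 0 < L) :
    DifferentiableAt ℝ (fun w : ℝ => v * frakgW c' D j 7 (Q / w) / (L : ℂ)) t ∧
      ‖v * frakgW c' D j 7 (Q / t) / (L : ℂ)‖ ≤ 146 * (‖v‖ / L) ∧
      ‖deriv (fun w : ℝ => v * frakgW c' D j 7 (Q / w) / (L : ℂ)) t‖ ≤ 449 * alpha D * (‖v‖ / L) / t := by
  obtain ⟨d7, n7, n7'⟩ := frakgW_div_bounds c' j 7 hα hℓ hc hQ hQT ht1 htT hT
  have hLC : ‖(L : ℂ)‖ = L := Complex.norm_of_nonneg hL.le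
  have hd : HasDerivAt (fun w : ℝ => v * frakgW c' D j 7 (Q / w) / (L : ℂ))
      (v * deriv (fun w : ℝ => frakgW c' D j 7 (Q / w)) t / (L : ℂ)) t :=
    (d7.hasDerivAt.const_mul v).div_const _
  refine ⟨hd.differentiableAt, ?_, ?_⟩
  · rw [norm_div, norm_mul, hLC]
    calc ‖v‖ * ‖frakgW c' D j 7 (Q / t)‖ / L ≤ ‖v‖ * 146 / L := by gcongr
      _ = 146 * (‖v‖ / L) := by ring
  · rw [hd.deriv, norm_div, norm_mul, hLC]
    calc ‖v‖ * ‖deriv (fun w : ℝ => frakgW c' D j 7 (Q / w)) t‖ / L ≤ ‖v‖ * (449 * alpha D / t) / L := by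
          gcongr
      _ = 449 * alpha D * (‖v‖ / L) / t := by ring

end Single

/-! ### (PS9) -/

set_option maxHeartbeats 400000 in
/-- **(PS9), the partial-summation half of `Z22:§9.u004`, PROVED**:
`L′(1,χ)²[Σ_{n<⌈P₃⌉}|χ(n)|λ₀ⱼ(n)φ(n)⁻¹Φ(n) + Σ_{⌈P₃⌉≤n<⌈P₂⌉}|χ(n)|λ₀ⱼ(n)φ(n)⁻¹Ψ(n)]
 = 𝔞·(int9main_j + |ι₄|²·int9tail_j) + o(α)` — three applications of the range-sum engine
`Section8RangeEngine.weighted_sum_integral_eval` (d29) with the profile bounds of `Section8AbelProfiles`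
at the scales `P₃, P₂`; total error `≤ 3|C|(423400 + 2674500π)𝓛⁻¹² ≤ (ε/2)α`. This is exactly the
hypothesis `hPS` of `Section9FrontEndExact.step9u004r_of_parts`.
[cite: Zhang2022LandauSiegel, §9 p.51, tex L2613–L2618; §8 (8.11) p.48] -/
theorem ps9 (c' : ℝ) :
    ∀ ε : ℝ, 0 < ε → ForAllLarge fun D _ χ => AssumptionA D χ →
      ∀ j ∈ ({1, 2, 3} : Finset ℕ),
        ‖(deriv χ.LFunction 1 ^ 2 *
                (∑ n ∈ Finset.Ico 1 ⌈Skeleton.P3 D⌉₊,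
                  (‖χ (n : ZMod D)‖ : ℂ) * lamZero c' D j n / (Nat.totient n : ℂ) *
                    ((conj iota3 * frakfW c' D j 6 (Skeleton.P3 D / n) / (Real.log (Skeleton.P3 D) : ℂ) +
                        conj iota4 * frakfW c' D j 7 (Skeleton.P2 D / n) / (Real.log (Skeleton.P2 D) : ℂ)) *
                      (iota3 * frakgW c' D j 6 (Skeleton.P3 D / n) / (Real.log (Skeleton.P3 D) : ℂ) +
                        iota4 * frakgW c' D j 7 (Skeleton.P2 D / n) / (Real.log (Skeleton.P2 D) : ℂ)))) +
              deriv χ.LFunction 1 ^ 2 *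
                (∑ n ∈ Finset.Ico ⌈Skeleton.P3 D⌉₊ ⌈Skeleton.P2 D⌉₊,
                  (‖χ (n : ZMod D)‖ : ℂ) * lamZero c' D j n / (Nat.totient n : ℂ) *
                    (conj iota4 * frakfW c' D j 7 (Skeleton.P2 D / n) / (Real.log (Skeleton.P2 D) : ℂ) *
                      (iota4 * frakgW c' D j 7 (Skeleton.P2 D / n) / (Real.log (Skeleton.P2 D) : ℂ))))) -
            (frakA χ : ℂ) * (Section9Statements.int9main c' D j +
              (Complex.normSq iota4 : ℂ) * Section9Statements.int9tail c' D j)‖ ≤ ε * alpha D := by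
  intro ε hε
  obtain ⟨C, hE⟩ := weighted_sum_integral_eval c'
  set Q : ℝ := 3 * (423400 + 2674500 * π) with hQ
  have hQ0 : 0 ≤ Q := by positivity
  have FL : ForAllLarge fun D _ _ =>
      4 ≤ ell D ∧ 5 * |c'| * π ≤ ell D ∧ 2 * |C| * Q / (ε * π) ≤ ell D :=
    ForAllLarge.of_le (max ⌈Real.exp 4⌉₊ (max ⌈Real.exp (5 * |c'| * π)⌉₊ ⌈Real.exp (2 * |C| * Q / (ε * π))⌉₊))
      fun D _ _ hD _ _ =>
        ⟨four_le_ell (le_trans (le_max_left _ _) hD),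
          le_ell_of_le' (le_trans ((le_max_left _ _).trans (le_max_right _ _)) hD),
          le_ell_of_le' (le_trans ((le_max_right _ _).trans (le_max_right _ _)) hD)⟩
  refine (hE.and FL).mono ?_
  intro D _ χ hq hp h hA j hj
  obtain ⟨eng, hℓ4, hc5, hCQ⟩ := h
  replace eng := eng j hj
  -- parameters
  have hℓ3 : 3 ≤ ell D := by linarith
  have hℓ0 : 0 < ell D := by linarith
  have hℓ1 : 1 ≤ ell D := by linarith
  have h9 : 0 < ell D ^ 9 := by positivity
  have hα : alpha D = π / ell D ^ 9 := by rw [Skeleton.alpha, log_bigP]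
  have hα0 : 0 < alpha D := by rw [hα]; positivity
  have hc : 5 * |c'| * alpha D * ell D ≤ 1 := by
    have h8 : ell D ≤ ell D ^ 8 := le_self_pow₀ hℓ1 (by norm_num)
    have e : 5 * |c'| * alpha D * ell D = 5 * |c'| * π / ell D ^ 8 := by
      rw [hα]; field_simp
    rw [e, div_le_one (by positivity)]
    linarith
  obtain ⟨hL3, hL2lo, hL2hi, hP3two, hP32, hP2P⟩ := scale_facts (D := D) hℓ4
  have hP3pos : 0 < Skeleton.P3 D := by linarith
  have hP2pos : 0 < Skeleton.P2 D := by linarith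
  have hP2two : 2 ≤ Skeleton.P2 D := le_trans hP3two hP32
  have hP3P : Skeleton.P3 D ≤ bigP D := hP32.trans hP2P
  have hlogP3 : 0 < Real.log (Skeleton.P3 D) := by rw [hL3]; positivity
  have hlogP2 : 0 < Real.log (Skeleton.P2 D) := lt_of_lt_of_le (by positivity) hL2lo
  set T : ℝ := Skeleton.P2 D + 1 with hT
  have hTα : alpha D * Real.log T ≤ 4 := by
    rw [hα]; exact alpha_log_succ_P2_le hℓ4 (by linarith) hL2hi
  set L3 : ℝ := Real.log (Skeleton.P3 D) with hL3def
  set L2 : ℝ := Real.log (Skeleton.P2 D) with hL2def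
  set κ : ℝ := ‖iota3‖ / L3 + ‖iota4‖ / L2 with hκ
  have hκ0 : 0 ≤ κ := by positivity
  have hκ10 : κ ≤ 10 / ell D ^ 9 := by rw [hκ]; exact kappa9_le hℓ4 hL3 hL2lo
  have hκ4 : ‖iota4‖ / L2 ≤ κ := by rw [hκ]; linarith [div_nonneg (norm_nonneg iota3) hlogP3.le]
  have hc3 : ‖conj iota3‖ = ‖iota3‖ := Complex.norm_conj _
  have hc4 : ‖conj iota4‖ = ‖iota4‖ := Complex.norm_conj _
  -- the two profiles and their bounds on `[1, T]`
  set FF : ℝ → ℂ := fun u =>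
    (conj iota3 * frakfW c' D j 6 (Skeleton.P3 D / u) / (L3 : ℂ) +
        conj iota4 * frakfW c' D j 7 (Skeleton.P2 D / u) / (L2 : ℂ)) *
      (iota3 * frakgW c' D j 6 (Skeleton.P3 D / u) / (L3 : ℂ) +
        iota4 * frakgW c' D j 7 (Skeleton.P2 D / u) / (L2 : ℂ)) with hFF
  set GG : ℝ → ℂ := fun u =>
    conj iota4 * frakfW c' D j 7 (Skeleton.P2 D / u) / (L2 : ℂ) *
      (iota4 * frakgW c' D j 7 (Skeleton.P2 D / u) / (L2 : ℂ)) with hGG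
  have bF : ∀ t ∈ Set.Icc 1 T, DifferentiableAt ℝ FF t ∧ ‖FF t‖ ≤ 29 * κ * (146 * κ) ∧
      ‖deriv FF t‖ ≤ (94 * alpha D * κ * (146 * κ) + 29 * κ * (449 * alpha D * κ)) / t := by
    intro t ht
    have hP3T : Skeleton.P3 D ≤ T := by rw [hT]; linarith
    have hP2T : Skeleton.P2 D ≤ T := by rw [hT]; linarith
    obtain ⟨dm, nm, nm'⟩ := mFac9_bounds c' j (conj iota3) (conj iota4) hα0 hℓ0.le hc
      (by linarith) (by linarith) hP3T hP2T ht.1 ht.2 hTα hlogP3 hlogP2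
    obtain ⟨dn, nn, nn'⟩ := nFac9_bounds c' j iota3 iota4 hα0 hℓ0.le hc
      (by linarith) (by linarith) hP3T hP2T ht.1 ht.2 hTα hlogP3 hlogP2
    rw [hc3, hc4] at nm nm'
    exact mul_bounds
      (f := fun w : ℝ => conj iota3 * frakfW c' D j 6 (Skeleton.P3 D / w) / (L3 : ℂ) +
        conj iota4 * frakfW c' D j 7 (Skeleton.P2 D / w) / (L2 : ℂ))
      (g := fun w : ℝ => iota3 * frakgW c' D j 6 (Skeleton.P3 D / w) / (L3 : ℂ) +
        iota4 * frakgW c' D j 7 (Skeleton.P2 D / w) / (L2 : ℂ))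
      dm dn nm nn nm' nn' (by positivity)
  have bG : ∀ t ∈ Set.Icc 1 T, DifferentiableAt ℝ GG t ∧ ‖GG t‖ ≤ 29 * κ * (146 * κ) ∧
      ‖deriv GG t‖ ≤ (94 * alpha D * κ * (146 * κ) + 29 * κ * (449 * alpha D * κ)) / t := by
    intro t ht
    have hP2T : Skeleton.P2 D ≤ T := by rw [hT]; linarith
    have ht0 : 0 < t := by linarith [ht.1]
    obtain ⟨dm, nm, nm'⟩ := sFacF_bounds c' j (conj iota4) hα0 hℓ0.le hc (by linarith) hP2T ht.1 ht.2 hTα hlogP2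
    obtain ⟨dn, nn, nn'⟩ := sFacG_bounds c' j iota4 hα0 hℓ0.le hc (by linarith) hP2T ht.1 ht.2 hTα hlogP2
    rw [hc4] at nm nm'
    have nm2 : ‖conj iota4 * frakfW c' D j 7 (Skeleton.P2 D / t) / (L2 : ℂ)‖ ≤ 29 * κ :=
      nm.trans (mul_le_mul_of_nonneg_left hκ4 (by norm_num))
    have nm2' : ‖deriv (fun w : ℝ => conj iota4 * frakfW c' D j 7 (Skeleton.P2 D / w) / (L2 : ℂ)) t‖ ≤
        94 * alpha D * κ / t :=
      nm'.trans (div_le_div_of_nonneg_right (mul_le_mul_of_nonneg_left hκ4 (by positivity)) ht0.le)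
    have nn2 : ‖iota4 * frakgW c' D j 7 (Skeleton.P2 D / t) / (L2 : ℂ)‖ ≤ 146 * κ :=
      nn.trans (mul_le_mul_of_nonneg_left hκ4 (by norm_num))
    have nn2' : ‖deriv (fun w : ℝ => iota4 * frakgW c' D j 7 (Skeleton.P2 D / w) / (L2 : ℂ)) t‖ ≤
        449 * alpha D * κ / t :=
      nn'.trans (div_le_div_of_nonneg_right (mul_le_mul_of_nonneg_left hκ4 (by positivity)) ht0.le)
    exact mul_bounds
      (f := fun w : ℝ => conj iota4 * frakfW c' D j 7 (Skeleton.P2 D / w) / (L2 : ℂ))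
      (g := fun w : ℝ => iota4 * frakgW c' D j 7 (Skeleton.P2 D / w) / (L2 : ℂ))
      dm dn nm2 nn2 nm2' nn2' (by positivity)
  -- the three engine applications
  have engF := eng (Skeleton.P3 D) (29 * κ * (146 * κ))
    (94 * alpha D * κ * (146 * κ) + 29 * κ * (449 * alpha D * κ)) FF hP3two hP3P (by positivity)
    (by positivity) (fun t ht => (bF t ⟨ht.1, by rw [hT]; linarith [ht.2]⟩).1)
    (fun t ht => (bF t ⟨ht.1, by rw [hT]; linarith [ht.2]⟩).2.1)
    (fun t ht => (bF t ⟨ht.1, by rw [hT]; linarith [ht.2]⟩).2.2)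
  have engG1 := eng (Skeleton.P2 D) (29 * κ * (146 * κ))
    (94 * alpha D * κ * (146 * κ) + 29 * κ * (449 * alpha D * κ)) GG hP2two hP2P (by positivity)
    (by positivity) (fun t ht => (bG t ⟨ht.1, by rw [hT]; linarith [ht.2]⟩).1)
    (fun t ht => (bG t ⟨ht.1, by rw [hT]; linarith [ht.2]⟩).2.1)
    (fun t ht => (bG t ⟨ht.1, by rw [hT]; linarith [ht.2]⟩).2.2)
  have engG2 := eng (Skeleton.P3 D) (29 * κ * (146 * κ))
    (94 * alpha D * κ * (146 * κ) + 29 * κ * (449 * alpha D * κ)) GG hP3two hP3P (by positivity)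
    (by positivity) (fun t ht => (bG t ⟨ht.1, by rw [hT]; linarith [ht.2]⟩).1)
    (fun t ht => (bG t ⟨ht.1, by rw [hT]; linarith [ht.2]⟩).2.1)
    (fun t ht => (bG t ⟨ht.1, by rw [hT]; linarith [ht.2]⟩).2.2)
  -- numeric size of the errors
  have errF := errF_le (C := C) hℓ3 hκ0 hκ10
  rw [← hα] at errF
  have htot := total_err_le hℓ3 hε hQ0 hCQ
  -- names
  set Ld : ℂ := deriv χ.LFunction 1 ^ 2 with hLd
  set w : ℕ → ℂ := fun n => (‖χ (n : ZMod D)‖ : ℂ) * lamZero c' D j n / (Nat.totient n : ℂ) with hw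
  set N2 : ℕ := ⌈Skeleton.P2 D⌉₊ with hN2
  set N3 : ℕ := ⌈Skeleton.P3 D⌉₊ with hN3
  have hN32 : N3 ≤ N2 := Nat.ceil_mono hP32
  have hN3one : 1 ≤ N3 := Nat.one_le_ceil_iff.mpr (by linarith)
  set SF : ℂ := ∑ n ∈ Finset.Ico 1 N3, w n * FF n with hSF
  set SG1 : ℂ := ∑ n ∈ Finset.Ico 1 N2, w n * GG n with hSG1
  set SG2 : ℂ := ∑ n ∈ Finset.Ico 1 N3, w n * GG n with hSG2
  set SG : ℂ := ∑ n ∈ Finset.Ico N3 N2, w n * GG n with hSG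
  set IF : ℂ := ∫ t in (1 : ℝ)..Skeleton.P3 D, FF t / t with hIF
  set IG1 : ℂ := ∫ t in (1 : ℝ)..Skeleton.P2 D, GG t / t with hIG1
  set IG2 : ℂ := ∫ t in (1 : ℝ)..Skeleton.P3 D, GG t / t with hIG2
  set IG : ℂ := ∫ t in Skeleton.P3 D..Skeleton.P2 D, GG t / t with hIG
  have hSG_split : SG = SG1 - SG2 := by
    rw [hSG, hSG1, hSG2, ← Finset.sum_Ico_consecutive _ hN3one hN32]
    ring
  have hGcont : ContinuousOn (fun t : ℝ => GG t / (t : ℂ)) (Set.Icc 1 T) := by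
    refine ContinuousOn.div (fun t ht => (bG t ht).1.continuousAt.continuousWithinAt)
      Complex.continuous_ofReal.continuousOn fun t ht => ?_
    exact_mod_cast (by linarith [ht.1] : t ≠ 0)
  have hIG_split : IG = IG1 - IG2 := by
    rw [hIG, hIG1, hIG2, intervalIntegral.integral_interval_sub_left]
    · exact (hGcont.mono fun t ht => by
        rw [Set.uIcc_of_le (by linarith : (1:ℝ) ≤ Skeleton.P2 D)] at ht
        exact ⟨ht.1, by rw [hT]; linarith [ht.2]⟩).intervalIntegrable
    · exact (hGcont.mono fun t ht => by
        rw [Set.uIcc_of_le (by linarith : (1:ℝ) ≤ Skeleton.P3 D)] at ht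
        exact ⟨ht.1, by rw [hT]; linarith [ht.2]⟩).intervalIntegrable
  -- the main terms are `𝔞·IF` and `𝔞·IG`
  have hIFeq : Section9Statements.int9main c' D j = IF := by
    rw [hIF, Section9Statements.int9main]
  have hIGeq : (Complex.normSq iota4 : ℂ) * Section9Statements.int9tail c' D j = IG := by
    rw [hIG, Section9Statements.int9tail, Complex.normSq_eq_conj_mul_self]
    have hL2ne : (L2 : ℂ) ≠ 0 := by exact_mod_cast hlogP2.ne'
    have hpt : ∀ t : ℝ, GG t / (t : ℂ) = (conj iota4 * iota4 / (L2 : ℂ) ^ 2) *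
        (frakfW c' D j 7 (Skeleton.P2 D / t) * frakgW c' D j 7 (Skeleton.P2 D / t) / (t : ℂ)) := by
      intro t; simp only [hGG]; ring
    rw [intervalIntegral.integral_congr (g := fun t : ℝ => (conj iota4 * iota4 / (L2 : ℂ) ^ 2) *
        (frakfW c' D j 7 (Skeleton.P2 D / t) * frakgW c' D j 7 (Skeleton.P2 D / t) / (t : ℂ)))
        (fun t _ => hpt t),
      intervalIntegral.integral_const_mul]
    have e2 : ((Real.log (Skeleton.P2 D) : ℝ) : ℂ) = (L2 : ℂ) := by rw [hL2def]
    rw [e2]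
    field_simp
  -- assemble
  rw [hIFeq, hIGeq]
  have key : Ld * SF + Ld * SG - (frakA χ : ℂ) * (IF + IG) =
      (Ld * SF - (frakA χ : ℂ) * IF) +
        ((Ld * SG1 - (frakA χ : ℂ) * IG1) - (Ld * SG2 - (frakA χ : ℂ) * IG2)) := by
    rw [hSG_split, hIG_split]; ring
  have engF' : ‖Ld * SF - (frakA χ : ℂ) * IF‖ ≤ |C| * (423400 + 2674500 * π) / ell D ^ 12 :=
    engF.trans errF
  have engG1' : ‖Ld * SG1 - (frakA χ : ℂ) * IG1‖ ≤ |C| * (423400 + 2674500 * π) / ell D ^ 12 :=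
    engG1.trans errF
  have engG2' : ‖Ld * SG2 - (frakA χ : ℂ) * IG2‖ ≤ |C| * (423400 + 2674500 * π) / ell D ^ 12 :=
    engG2.trans errF
  rw [key]
  calc ‖(Ld * SF - (frakA χ : ℂ) * IF) +
        ((Ld * SG1 - (frakA χ : ℂ) * IG1) - (Ld * SG2 - (frakA χ : ℂ) * IG2))‖
      ≤ ‖Ld * SF - (frakA χ : ℂ) * IF‖ +
        ‖(Ld * SG1 - (frakA χ : ℂ) * IG1) - (Ld * SG2 - (frakA χ : ℂ) * IG2)‖ := norm_add_le _ _
    _ ≤ |C| * (423400 + 2674500 * π) / ell D ^ 12 +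
        (|C| * (423400 + 2674500 * π) / ell D ^ 12 + |C| * (423400 + 2674500 * π) / ell D ^ 12) :=
        add_le_add engF' ((norm_sub_le _ _).trans (add_le_add engG1' engG2'))
    _ = |C| * Q / ell D ^ 12 := by rw [hQ]; ring
    _ ≤ ε / 2 * alpha D := by rw [hα]; exact htot
    _ ≤ ε * alpha D := by nlinarith [hα0]

/-- **`Step9u004r` from the gathering (G9) alone**: (PS9) is now a theorem, so
`Section9FrontEndExact.step9u004r_of_parts` needs only its first hypothesis — the §9 twin of
`Z22:§8.u044` (insert the main terms of Lemmas 8.2/8.4 into `Sj_a12_a22_eq` with total error `o(α)`).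
[cite: Zhang2022LandauSiegel, §9 p.51, tex L2613–L2618] -/
theorem step9u004r_of_gathering9 (c' : ℝ)
    (hG : ∀ ε : ℝ, 0 < ε → ForAllLarge fun D _ χ => AssumptionA D χ →
      ∀ j ∈ ({1, 2, 3} : Finset ℕ),
        ‖Sj c' D j (a12 χ) (a22 χ) -
            (deriv χ.LFunction 1 ^ 2 *
                (∑ n ∈ Finset.Ico 1 ⌈Skeleton.P3 D⌉₊, ∑ p ∈ Nat.divisorsAntidiagonal n,
                  ((ArithmeticFunction.moebius p.2).natAbs : ℂ) *
                        (‖χ ((p.1 * p.2 : ℕ) : ZMod D)‖ : ℂ) /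
                      (((p.1 * p.2 : ℕ) : ℂ) * (Nat.totient p.2 : ℂ)) *
                    lamZero c' D j (p.1 * p.2) * PiW χ p.1 p.2 *
                    ((conj iota3 * frakfW c' D j 6 (Skeleton.P3 D / n) / (Real.log (Skeleton.P3 D) : ℂ) +
                        conj iota4 * frakfW c' D j 7 (Skeleton.P2 D / n) / (Real.log (Skeleton.P2 D) : ℂ)) *
                      (iota3 * frakgW c' D j 6 (Skeleton.P3 D / n) / (Real.log (Skeleton.P3 D) : ℂ) +
                        iota4 * frakgW c' D j 7 (Skeleton.P2 D / n) / (Real.log (Skeleton.P2 D) : ℂ)))) +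
              deriv χ.LFunction 1 ^ 2 *
                (∑ n ∈ Finset.Ico ⌈Skeleton.P3 D⌉₊ ⌈Skeleton.P2 D⌉₊, ∑ p ∈ Nat.divisorsAntidiagonal n,
                  ((ArithmeticFunction.moebius p.2).natAbs : ℂ) *
                        (‖χ ((p.1 * p.2 : ℕ) : ZMod D)‖ : ℂ) /
                      (((p.1 * p.2 : ℕ) : ℂ) * (Nat.totient p.2 : ℂ)) *
                    lamZero c' D j (p.1 * p.2) * PiW χ p.1 p.2 *
                    (conj iota4 * frakfW c' D j 7 (Skeleton.P2 D / n) / (Real.log (Skeleton.P2 D) : ℂ) *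
                      (iota4 * frakgW c' D j 7 (Skeleton.P2 D / n) / (Real.log (Skeleton.P2 D) : ℂ)))))‖
          ≤ ε * alpha D) :
    Section9Statements.Step9u004r c' :=
  Section9FrontEndExact.step9u004r_of_parts c' hG (ps9 c')

end Literature.NumberTheory.LFunctions.Zhang2022.Section9PartialSummation

end
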